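import Summits.BirchSwinnertonDyer.BirchSwinnertonDyer.Theorems.PrintCFramBottomClassIndexLawFiveLeAnchorBernoulli163Twin
import Summits.BirchSwinnertonDyer.Rank1Residual.X12.O11.RouteUPrimePsi
import Summits.BirchSwinnertonDyer.Rank1Residual.X12.O11.RouteUEulerCriterionNat
import Mathlib.Tactic.NormNum.LegendreSymbol
import HarnessLib

/-!
# Crux `PrintCFram.BottomClassIndexLawFiveLe` (stmt-BirchSwinnertonDyer-20372), line `eisenstein-resource-bdp-line` (registry v10):
# KIT for the Kriz–Li (4)-CERTIFICATE TABLES of the TWISTED window classes at `p ∈ {11, 19, 43, 67}` — one table lemma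
# `‖B_{1,θ}‖_p = 1 ⟸ (integer congruence mod p²)` for characters `θ(j) = c(j)·ω(j)^k` mod `p·N` with an ARBITRARY integer
# value function `c`, and the Kronecker value tables `[a odd]·(d/a)` for `d ∈ {2, 6, 7, 10, 14, 15}`
# (cell `bsd-print-cfram`, width seat `bsd-line-cfram-p1-w5` g0; THEOREMS ONLY, `--supports` 20372; BSD is not proved by any of this)

HONEST FRAMING. Nothing here is a statement about BSD or about any curve. The Kriz–Li datum of the v10 composition
(`Cruxes/BottomClassIndexLawFiveLe/Lines/eisenstein_resource_bdp_line.lean`, the `∃ (Kriz–Li datum)` of its case split) carries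
hypothesis (4) `B_{1,ψ₀⁻¹ε_K}·B_{1,ψ₀ω⁻¹} ≢ 0 (mod p)`. For a TWISTED rank-one window class `W ∼ A(p)^{(d)}` the class character is
`ψ = χ_d·ω^k`, `k = (p+1)/4`, ODD (w2 g4 census), so the pair is `B_{1,ψ⁻¹}·B_{1,ψε_Kω⁻¹}` with `ψ⁻¹ = χ_d·ω^{p−1−k}` (level
`p·m_d`) and `ψε_Kω⁻¹ = χ_d·ε_K·ω^{k−1}` (level `p·m_d·|d_K|`) (`…RegularLocusBernoulliPairOdd`). The base curves `A(11), A(19),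
A(43), A(67)` were certified by w3 g2 (`…KrizLiBindersAnchor11/19/43/67`), the `p = 7` classes by cell `bsd-cm`'s Route U members;
the 33 twisted classes at `p ≥ 11` are certified in the companion files `…KrizLi4Cert11/19/43/67*.lean` by the ONE reduction
of this file:

* §1 `norm_generalizedBernoulli_eq_one_of_table` — for `ω` Teichmüller mod `p`, `k ≠ 0`, `θ` mod `p·N` (`p ∤ N`) with values
  `θ(j) = c(j)·ω(j mod p)^k` for an integer function `c`, a unit `a ≡ 1 (mod p)` with `c(a) = −1` (so `θ ≠ 1`), and a table
  `t(j) ≡ j^{pk} (mod p²)` (`0 < j < p`): if `S = Σ_{j<pN} c(j)·t(j mod p)·j` has `p ∣ S`, `p² ∤ S` then `‖B_{1,θ}‖_p = 1`.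
  (= w2's `AnchorReduction.norm_generalizedBernoulli_legendre_teichmullerPow_of_cert` with the Legendre symbol replaced by any
  `c`, through cell `bsd-cm`'s `RouteU.norm_generalizedBernoulli_one_eq_one_of_cert_range`; the sum is over `Finset.range` so
  that long certificates split into `Finset.Ico` blocks.)
* §2 `kroneckerFour_{two,six,seven,ten,fourteen,fifteen}_eq_ite` — the values `[a odd]·J(d | a)` of the Kronecker character of
  conductor `4d` (the `χ` of w3 g2's `KrizLiBinders.krizLiBinders_of_coprime_twist_even`) as an `if` on `a mod 4d`
  (`jacobiSym.mod_right`), so that certificate sums evaluate by `decide +kernel`; `d = 3` is w3 g3's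
  `OffLocus.kroneckerFour_three_eq_ite`.

beyond-print theorem: NO. References: [Washington1997] §5.1 (Teichmüller character), Thm. 4.2 (`B_{1,χ} = f⁻¹ Σ χ(a) a`);
[KrizLi2019] §1.5 (1), Thm. 1.20 (4); [Cox2013] §1.C Lemma 1.14 (Jacobi/Kronecker symbol, periodicity).
-/

noncomputable section

-- summit-side namespace `Summit.BirchSwinnertonDyer.BirchSwinnertonDyer.…` (single-conjunct summit, D-0017 layout)
set_option linter.dupNamespace false

open scoped Classical NumberTheorySymbols

open DirichletCharacter Literature.NumberTheory.EllipticCurves.KrizLi2019 Literature.NumberTheory.LFunctions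
  Summit.BirchSwinnertonDyer.Rank1Residual.X12.O11
  Summit.BirchSwinnertonDyer.BirchSwinnertonDyer.Theorems.PrintCFram

namespace Summit.BirchSwinnertonDyer.BirchSwinnertonDyer.Theorems.PrintCFram.KrizLi4Cert

/-! ## §1 The table reduction with an arbitrary integer value function -/

/-- **Table certificate for `‖B_{1,θ}‖_p = 1`, `θ(j) = c(j)·ω(j)^k` mod `p·N`.** Let `ω` be the Teichmüller character mod `p`,
`k ≠ 0`, `p ∤ N` (as `ord_p(pN) = 1`), `θ` a `ℚ_p`-valued character mod `p·N` with values `θ(j) = c(j)·ω(j mod p)^k` for an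
integer function `c`, `a < pN` a unit with `a ≡ 1 (mod p)` and `c(a) = −1` (hence `θ(a) = −1`, `θ ≠ 1`), and `t` a table with
`t(0) = 0`, `j^{pk} ≡ t(j) (mod p²)` for `0 < j < p` (so `‖ω(j)^k − t(j mod p)‖ ≤ p⁻²`). If `S = Σ_{j<pN} c(j)·t(j mod p)·j` has
`p ∣ S` and `p² ∤ S`, then `B_{1,θ} = (pN)⁻¹ Σ θ(j) j` is a `p`-adic unit. [cite: Washington1997, §5.1 and Thm. 4.2]
[cite: KrizLi2019, §1.5 display (1) (p. 7)] -/
theorem norm_generalizedBernoulli_eq_one_of_table {p N : ℕ} [hp : Fact p.Prime] [NeZero N]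
    (ω : DirichletCharacter ℚ_[p] p) (hω : IsTeichmullerCharacter ω) {k : ℕ} (hk : k ≠ 0)
    (hpN : padicValNat p (p * N) = 1) (c : ℕ → ℤ)
    (θ : DirichletCharacter ℚ_[p] (p * N))
    (hθ : ∀ j : ZMod (p * N), θ j = (c j.val : ℚ_[p]) * ω (j.val : ZMod p) ^ k)
    {a : ℕ} (ha : a < p * N) (hap : a % p = 1) (hac : Nat.Coprime a (p * N)) (hca : c a = -1)
    (t : ℕ → ℕ) (ht0 : t 0 = 0) (ht : ∀ j, j < p → j ≠ 0 → j ^ (p * k) ≡ t j [MOD p ^ 2])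
    (S : ℤ) (hS : ∑ j ∈ Finset.range (p * N), (c j * ((t (j % p) : ℕ) : ℤ)) * (j : ℤ) ^ (0 + 1) = S)
    (h1 : (p : ℤ) ∣ S) (h2 : ¬ (p : ℤ) ^ 2 ∣ S) :
    ‖generalizedBernoulli 1 θ‖ = 1 := by
  haveI : NeZero (p * N) := ⟨Nat.mul_ne_zero hp.out.ne_zero (NeZero.ne N)⟩
  -- `θ ≠ 1` from the witness `a`
  have hθ1 : θ ≠ 1 := by
    intro h
    have hA := hθ ((a : ℕ) : ZMod (p * N))
    have hv : ((a : ℕ) : ZMod (p * N)).val = a := by rw [ZMod.val_natCast, Nat.mod_eq_of_lt ha]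
    have hu : IsUnit ((a : ℕ) : ZMod (p * N)) := (ZMod.isUnit_iff_coprime a (p * N)).mpr hac
    have h1p : ((a : ℕ) : ZMod p) = 1 := by
      rw [← ZMod.natCast_mod a p, hap, Nat.cast_one]
    rw [h, MulChar.one_apply hu, hv, h1p, map_one, one_pow, mul_one, hca] at hA
    norm_num at hA
  refine RouteU.norm_generalizedBernoulli_one_eq_one_of_cert_range θ hθ1 hpN
    (fun j => c j * ((t (j % p) : ℕ) : ℤ)) 0 (fun j => ?_) S hS h1 h2
  rw [pow_zero, mul_one, hθ j]
  have hval : (j.val : ZMod p).val = j.val % p := ZMod.val_natCast _ _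
  have htab := AnchorReduction.norm_teichmuller_pow_sub_table_le ω hω hk t ht0 ht (j.val : ZMod p)
  rw [hval] at htab
  have hL : ‖(c j.val : ℚ_[p])‖ ≤ 1 := Padic.norm_int_le_one _
  have hsplit : (c j.val : ℚ_[p]) * ω (j.val : ZMod p) ^ k -
      ((c j.val * ((t (j.val % p) : ℕ) : ℤ) : ℤ) : ℚ_[p]) =
      (c j.val : ℚ_[p]) * (ω (j.val : ZMod p) ^ k - ((t (j.val % p) : ℕ) : ℚ_[p])) := by
    push_cast; ring
  rw [hsplit, norm_mul]
  calc ‖(c j.val : ℚ_[p])‖ * ‖ω (j.val : ZMod p) ^ k - ((t (j.val % p) : ℕ) : ℚ_[p])‖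
      ≤ 1 * (p : ℝ) ^ (-2 : ℤ) := mul_le_mul hL htab (norm_nonneg _) zero_le_one
    _ = (p : ℝ) ^ (-2 : ℤ) := one_mul _

/-- `ord_p(p·N) = 1` for `p ∤ N`. [folklore] -/
theorem padicValNat_mul_eq_one {p N : ℕ} [hp : Fact p.Prime] (hN : ¬ p ∣ N) : padicValNat p (p * N) = 1 := by
  have hN0 : N ≠ 0 := by rintro rfl; exact hN (dvd_zero p)
  rw [padicValNat.mul hp.out.ne_zero hN0, padicValNat_self, padicValNat.eq_zero_of_not_dvd hN]

/-! ## §2 Kronecker value tables `[a odd]·J(d | a)` for `d ∈ {2, 6, 7, 10, 14, 15}` -/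

/-- The values `[a odd]·(2/a)` (conductor `8`) as an `if` on `a mod 8`. [cite: Cox2013, §1.C Lemma 1.14] -/
theorem kroneckerFour_two_eq_ite (a : ℕ) :
    ((if Even a then (0 : ℤ) else J(2 | a)) : ℤ) =
      if a % 8 ∈ [1, 7] then 1 else if a % 8 ∈ [3, 5] then -1 else 0 := by
  by_cases ha : Even a
  · rw [if_pos ha]
    obtain ⟨r, hr⟩ := ha
    have h1 : a % 8 ∉ [1, 7] := by simp; omega
    have h2 : a % 8 ∉ [3, 5] := by simp; omega
    rw [if_neg h1, if_neg h2]
  · rw [if_neg ha]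
    have hodd : Odd a := Nat.not_even_iff_odd.mp ha
    rw [jacobiSym.mod_right (2 : ℤ) hodd, show (4 * (2 : ℤ).natAbs) = 8 from rfl]
    have hlt : a % 8 < 8 := Nat.mod_lt _ (by norm_num)
    have hodd' : a % 8 % 2 = 1 := by rw [Nat.mod_mod_of_dvd a (by norm_num : 2 ∣ 8)]; exact Nat.odd_iff.mp hodd
    generalize a % 8 = r at hlt hodd' ⊢
    interval_cases r <;> simp_all <;> norm_num

/-- The values `[a odd]·(6/a)` (conductor `24`) as an `if` on `a mod 24`. [cite: Cox2013, §1.C Lemma 1.14] -/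
theorem kroneckerFour_six_eq_ite (a : ℕ) :
    ((if Even a then (0 : ℤ) else J(6 | a)) : ℤ) =
      if a % 24 ∈ [1, 5, 19, 23] then 1 else if a % 24 ∈ [7, 11, 13, 17] then -1 else 0 := by
  by_cases ha : Even a
  · rw [if_pos ha]
    obtain ⟨r, hr⟩ := ha
    have h1 : a % 24 ∉ [1, 5, 19, 23] := by simp; omega
    have h2 : a % 24 ∉ [7, 11, 13, 17] := by simp; omega
    rw [if_neg h1, if_neg h2]
  · rw [if_neg ha]
    have hodd : Odd a := Nat.not_even_iff_odd.mp ha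
    rw [jacobiSym.mod_right (6 : ℤ) hodd, show (4 * (6 : ℤ).natAbs) = 24 from rfl]
    have hlt : a % 24 < 24 := Nat.mod_lt _ (by norm_num)
    have hodd' : a % 24 % 2 = 1 := by rw [Nat.mod_mod_of_dvd a (by norm_num : 2 ∣ 24)]; exact Nat.odd_iff.mp hodd
    generalize a % 24 = r at hlt hodd' ⊢
    interval_cases r <;> simp_all <;> norm_num

/-- The values `[a odd]·(7/a)` (conductor `28`) as an `if` on `a mod 28`. [cite: Cox2013, §1.C Lemma 1.14] -/
theorem kroneckerFour_seven_eq_ite (a : ℕ) :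
    ((if Even a then (0 : ℤ) else J(7 | a)) : ℤ) =
      if a % 28 ∈ [1, 3, 9, 19, 25, 27] then 1 else if a % 28 ∈ [5, 11, 13, 15, 17, 23] then -1 else 0 := by
  by_cases ha : Even a
  · rw [if_pos ha]
    obtain ⟨r, hr⟩ := ha
    have h1 : a % 28 ∉ [1, 3, 9, 19, 25, 27] := by simp; omega
    have h2 : a % 28 ∉ [5, 11, 13, 15, 17, 23] := by simp; omega
    rw [if_neg h1, if_neg h2]
  · rw [if_neg ha]
    have hodd : Odd a := Nat.not_even_iff_odd.mp ha
    rw [jacobiSym.mod_right (7 : ℤ) hodd, show (4 * (7 : ℤ).natAbs) = 28 from rfl]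
    have hlt : a % 28 < 28 := Nat.mod_lt _ (by norm_num)
    have hodd' : a % 28 % 2 = 1 := by rw [Nat.mod_mod_of_dvd a (by norm_num : 2 ∣ 28)]; exact Nat.odd_iff.mp hodd
    generalize a % 28 = r at hlt hodd' ⊢
    interval_cases r <;> simp_all <;> norm_num

/-- The values `[a odd]·(10/a)` (conductor `40`) as an `if` on `a mod 40`. [cite: Cox2013, §1.C Lemma 1.14] -/
theorem kroneckerFour_ten_eq_ite (a : ℕ) :
    ((if Even a then (0 : ℤ) else J(10 | a)) : ℤ) =
      if a % 40 ∈ [1, 3, 9, 13, 27, 31, 37, 39] then 1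
      else if a % 40 ∈ [7, 11, 17, 19, 21, 23, 29, 33] then -1 else 0 := by
  by_cases ha : Even a
  · rw [if_pos ha]
    obtain ⟨r, hr⟩ := ha
    have h1 : a % 40 ∉ [1, 3, 9, 13, 27, 31, 37, 39] := by simp; omega
    have h2 : a % 40 ∉ [7, 11, 17, 19, 21, 23, 29, 33] := by simp; omega
    rw [if_neg h1, if_neg h2]
  · rw [if_neg ha]
    have hodd : Odd a := Nat.not_even_iff_odd.mp ha
    rw [jacobiSym.mod_right (10 : ℤ) hodd, show (4 * (10 : ℤ).natAbs) = 40 from rfl]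
    have hlt : a % 40 < 40 := Nat.mod_lt _ (by norm_num)
    have hodd' : a % 40 % 2 = 1 := by rw [Nat.mod_mod_of_dvd a (by norm_num : 2 ∣ 40)]; exact Nat.odd_iff.mp hodd
    generalize a % 40 = r at hlt hodd' ⊢
    interval_cases r <;> simp_all <;> norm_num

/-- The values `[a odd]·(14/a)` (conductor `56`) as an `if` on `a mod 56`. [cite: Cox2013, §1.C Lemma 1.14] -/
theorem kroneckerFour_fourteen_eq_ite (a : ℕ) :
    ((if Even a then (0 : ℤ) else J(14 | a)) : ℤ) =
      if a % 56 ∈ [1, 5, 9, 11, 13, 25, 31, 43, 45, 47, 51, 55] then 1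
      else if a % 56 ∈ [3, 15, 17, 19, 23, 27, 29, 33, 37, 39, 41, 53] then -1 else 0 := by
  by_cases ha : Even a
  · rw [if_pos ha]
    obtain ⟨r, hr⟩ := ha
    have h1 : a % 56 ∉ [1, 5, 9, 11, 13, 25, 31, 43, 45, 47, 51, 55] := by simp; omega
    have h2 : a % 56 ∉ [3, 15, 17, 19, 23, 27, 29, 33, 37, 39, 41, 53] := by simp; omega
    rw [if_neg h1, if_neg h2]
  · rw [if_neg ha]
    have hodd : Odd a := Nat.not_even_iff_odd.mp ha
    rw [jacobiSym.mod_right (14 : ℤ) hodd, show (4 * (14 : ℤ).natAbs) = 56 from rfl]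
    have hlt : a % 56 < 56 := Nat.mod_lt _ (by norm_num)
    have hodd' : a % 56 % 2 = 1 := by rw [Nat.mod_mod_of_dvd a (by norm_num : 2 ∣ 56)]; exact Nat.odd_iff.mp hodd
    generalize a % 56 = r at hlt hodd' ⊢
    interval_cases r <;> simp_all <;> norm_num

/-- The values `[a odd]·(15/a)` (conductor `60`) as an `if` on `a mod 60`. [cite: Cox2013, §1.C Lemma 1.14] -/
theorem kroneckerFour_fifteen_eq_ite (a : ℕ) :
    ((if Even a then (0 : ℤ) else J(15 | a)) : ℤ) =
      if a % 60 ∈ [1, 7, 11, 17, 43, 49, 53, 59] then 1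
      else if a % 60 ∈ [13, 19, 23, 29, 31, 37, 41, 47] then -1 else 0 := by
  by_cases ha : Even a
  · rw [if_pos ha]
    obtain ⟨r, hr⟩ := ha
    have h1 : a % 60 ∉ [1, 7, 11, 17, 43, 49, 53, 59] := by simp; omega
    have h2 : a % 60 ∉ [13, 19, 23, 29, 31, 37, 41, 47] := by simp; omega
    rw [if_neg h1, if_neg h2]
  · rw [if_neg ha]
    have hodd : Odd a := Nat.not_even_iff_odd.mp ha
    rw [jacobiSym.mod_right (15 : ℤ) hodd, show (4 * (15 : ℤ).natAbs) = 60 from rfl]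
    have hlt : a % 60 < 60 := Nat.mod_lt _ (by norm_num)
    have hodd' : a % 60 % 2 = 1 := by rw [Nat.mod_mod_of_dvd a (by norm_num : 2 ∣ 60)]; exact Nat.odd_iff.mp hodd
    generalize a % 60 = r at hlt hodd' ⊢
    interval_cases r <;> simp_all <;> norm_num

/-! ## §3 (appended) Jacobi symbols at the composite moduli `21, 33, 39, 57, 87, 95` of the certificate files (`J(x | ab) = J(x | a)·J(x | b)`),
stated ONCE here so that no two certificate files declare the same name (`15`, `51`, `143` are `jacobiSym_split_15/51/143` of
`…KrizLi4Cert19A` / `…KrizLi4Cert67and43` / `…KrizLi4Cert19B`) -/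

/-- `J(x | 21) = J(x | 3)·J(x | 7)` (multiplicativity of the Jacobi symbol in the lower entry). [cite: Cox2013, §1.C Lemma 1.14] -/
theorem jacobiSym_lower_21 (x : ℤ) : J(x | 21) = J(x | 3) * J(x | 7) := by
  rw [show (21 : ℕ) = 3 * 7 from rfl]; exact RouteU.jacobiSym_mul_right' x (by norm_num) (by norm_num)

/-- `J(x | 33) = J(x | 3)·J(x | 11)` (multiplicativity of the Jacobi symbol in the lower entry). [cite: Cox2013, §1.C Lemma 1.14] -/
theorem jacobiSym_lower_33 (x : ℤ) : J(x | 33) = J(x | 3) * J(x | 11) := by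
  rw [show (33 : ℕ) = 3 * 11 from rfl]; exact RouteU.jacobiSym_mul_right' x (by norm_num) (by norm_num)

/-- `J(x | 39) = J(x | 3)·J(x | 13)` (multiplicativity of the Jacobi symbol in the lower entry). [cite: Cox2013, §1.C Lemma 1.14] -/
theorem jacobiSym_lower_39 (x : ℤ) : J(x | 39) = J(x | 3) * J(x | 13) := by
  rw [show (39 : ℕ) = 3 * 13 from rfl]; exact RouteU.jacobiSym_mul_right' x (by norm_num) (by norm_num)

/-- `J(x | 57) = J(x | 3)·J(x | 19)` (multiplicativity of the Jacobi symbol in the lower entry). [cite: Cox2013, §1.C Lemma 1.14] -/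
theorem jacobiSym_lower_57 (x : ℤ) : J(x | 57) = J(x | 3) * J(x | 19) := by
  rw [show (57 : ℕ) = 3 * 19 from rfl]; exact RouteU.jacobiSym_mul_right' x (by norm_num) (by norm_num)

/-- `J(x | 87) = J(x | 3)·J(x | 29)` (multiplicativity of the Jacobi symbol in the lower entry). [cite: Cox2013, §1.C Lemma 1.14] -/
theorem jacobiSym_lower_87 (x : ℤ) : J(x | 87) = J(x | 3) * J(x | 29) := by
  rw [show (87 : ℕ) = 3 * 29 from rfl]; exact RouteU.jacobiSym_mul_right' x (by norm_num) (by norm_num)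

/-- `J(x | 95) = J(x | 5)·J(x | 19)` (multiplicativity of the Jacobi symbol in the lower entry). [cite: Cox2013, §1.C Lemma 1.14] -/
theorem jacobiSym_lower_95 (x : ℤ) : J(x | 95) = J(x | 5) * J(x | 19) := by
  rw [show (95 : ℕ) = 5 * 19 from rfl]; exact RouteU.jacobiSym_mul_right' x (by norm_num) (by norm_num)

end Summit.BirchSwinnertonDyer.BirchSwinnertonDyer.Theorems.PrintCFram.KrizLi4Cert

end
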